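import Literature.NumberTheory.LFunctions.TaoLogElliottProp26
import Literature.NumberTheory.LFunctions.TaoLogElliottHoeffding
import Literature.NumberTheory.LFunctions.TaoLogElliottEndgame
import Literature.NumberTheory.LFunctions.TaoLogElliottBilinearPerturbation
import HarnessLib

/-!
# Tao's log-averaged Elliott theorem: Proposition 2.6 meets `F(X_H, Y_H)`

Part of the proof DAG below the named fact `Literature.NumberTheory.LFunctions.Tao2016_theorem23_core` (Tao, Forum Math. Pi 4
(2016) e8, proof of Theorem 2.3).  The conclusion (2.15) of Proposition 2.6 is stated in
`TaoLogElliottProp26.lean` for the random sum `Trest a b h g₁ g₂ 𝒫_H H (a𝐧)` built from the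
integrands `Z_{p,j}` of (2.16), while §3 works with "`F(X_H, Y_H)`, where `F` is the function
`F(x, y) = ∑_{p ∈ 𝒫_H} c_p ∑_{j, j+ph ∈ [1,H]} 1_{ay + j ≡ pb (ap)} x_{1,j} x_{2,j+ph}`"
(`Literature.NumberTheory.LFunctions.Tao2016.Fbil`, read through `y mod p` for each `p`, `TaoLogElliottHoeffding.lean`) evaluated
at the rows `x_{i,j}(𝐧) = gᵢ(a𝐧 + j)` (`Literature.NumberTheory.LFunctions.Tao2016.seqAt`) and `Y_H = 𝐧 mod P_H`.  This file
proves that the two agree ("we can write this as `|𝔼 F(X_H, Y_H)| ≫ ε H / log H`", the display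
(3.1)): `Trest_mul_eq_Fbil`.

## References
* T. Tao, Forum Math. Pi 4 (2016), e8; arXiv:1509.05422, §2 (definition of `F` before
  Remark 2.7) and §3, (3.1).
-/

open Finset Real Complex

namespace Literature.NumberTheory.LFunctions

namespace Tao2016

/-- Reindexing a sum over `[1, H] ⊆ ℕ` as a sum over `[1, H] ⊆ ℤ`. [folklore] -/
theorem sum_Icc_natCast_eq {M : Type*} [AddCommMonoid M] (f : ℤ → M) (H : ℕ) :
    ∑ j ∈ Icc 1 H, f (j : ℤ) = ∑ j ∈ Icc (1 : ℤ) H, f j := by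
  refine sum_nbij' (fun j : ℕ => (j : ℤ)) (fun j : ℤ => j.toNat) (fun j hj => ?_) (fun j hj => ?_)
    (fun j _ => Int.toNat_natCast j) (fun j hj => ?_) (fun _ _ => rfl)
  · rw [mem_Icc] at hj ⊢; omega
  · rw [mem_Icc] at hj ⊢; omega
  · rw [mem_Icc] at hj; omega

/-- **One prime of (3.1)**: for `p` prime, `p ∤ a`, `p ∣ P`,
`∑_{j ∈ [1,H], j+ph ∈ [1,H]} Z_{p,j}(a n) = F_p(x(n), n mod p)` with `x_i(n) = seqAt gᵢ (a n)` and
`c_p = conj g₁(p) conj g₂(p)`: the constraint `ap ∣ an + j - pb` splits as `p ∣ an + j` and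
`j ≡ pb (a)` (Chinese remainder theorem). [cite: TaoFMP2016, §3 (3.1)] -/
theorem sum_Zpj_mul_eq_Floc {g₁ g₂ : ℕ → ℂ} {a p : ℕ} (hp : p.Prime) (hpa : ¬p ∣ a)
    (b h : ℤ) (H n : ℕ) {P : ℕ} (hpP : p ∣ P) :
    ∑ j ∈ (Icc 1 H).filter (fun j : ℕ => 1 ≤ (j : ℤ) + p * h ∧ (j : ℤ) + p * h ≤ H),
        Zpj a b h g₁ g₂ p (j : ℤ) (a * n) =
      Floc a H b h (cCoeff g₁ g₂) (seqAt g₁ (a * n)) (seqAt g₂ (a * n)) p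
        (ZMod.cast ((n : ZMod P)) : ZMod p) := by
  have hcop : Nat.Coprime a p := Nat.coprime_comm.1 ((Nat.Prime.coprime_iff_not_dvd hp).2 hpa)
  have hcast : (ZMod.cast ((n : ZMod P)) : ZMod p) = (n : ZMod p) := ZMod.cast_natCast hpP n
  rw [hcast]
  unfold Floc jRange
  rw [mul_sum, sum_filter, sum_filter,
    sum_Icc_natCast_eq (fun j : ℤ => if 1 ≤ j + p * h ∧ j + p * h ≤ H then
      Zpj a b h g₁ g₂ p j (a * n) else 0) H]
  refine sum_congr rfl fun j _ => ?_
  have hsplit : ((a * n : ℕ) : ℤ) + j - p * b = a * n + (j - p * b) := by push_cast; ring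
  unfold Zpj seqAt
  by_cases hR : 1 ≤ j + p * h ∧ j + p * h ≤ H
  · have hR' : j + (p : ℤ) * h ∈ Icc (1 : ℤ) H := mem_Icc.2 hR
    rw [if_pos hR]
    by_cases hQ : (a : ℤ) ∣ j - p * b
    · rw [if_pos (show j + (p : ℤ) * h ∈ Icc (1 : ℤ) H ∧ (a : ℤ) ∣ j - p * b from ⟨hR', hQ⟩)]
      have hiff : ((a * p : ℕ) : ℤ) ∣ ((a * n : ℕ) : ℤ) + j - p * b ↔
          (p : ℤ) ∣ ((a * n : ℕ) : ℤ) + j := by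
        rw [mul_dvd_sub_iff hcop]
        constructor
        · exact fun h1 => h1.1
        · intro h1
          refine ⟨h1, ?_⟩
          rw [hsplit]
          exact dvd_add (dvd_mul_right _ _) hQ
      by_cases hD : (p : ℤ) ∣ ((a * n : ℕ) : ℤ) + j
      · rw [if_pos (hiff.2 hD), if_pos ((natCast_mul_natCast_add_intCast_eq_zero_iff p a n j).2 hD),
          mul_assoc, add_assoc]
      · rw [if_neg (mt hiff.1 hD),
          if_neg (mt (natCast_mul_natCast_add_intCast_eq_zero_iff p a n j).1 hD), mul_zero]
    · have hnot : ¬(((a * p : ℕ) : ℤ) ∣ ((a * n : ℕ) : ℤ) + j - p * b) := by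
        intro hD
        apply hQ
        have h2 := ((mul_dvd_sub_iff hcop _ _).1 hD).2
        rw [hsplit] at h2
        exact (dvd_add_right (dvd_mul_right (a : ℤ) n)).1 h2
      rw [if_neg (show ¬(j + (p : ℤ) * h ∈ Icc (1 : ℤ) H ∧ (a : ℤ) ∣ j - p * b) from
        fun h1 => hQ h1.2), if_neg hnot]
  · rw [if_neg hR, if_neg (show ¬(j + (p : ℤ) * h ∈ Icc (1 : ℤ) H ∧ (a : ℤ) ∣ j - p * b) from
      fun h1 => hR (mem_Icc.1 h1.1))]

/-- **Tao 2016, (3.1): `Trest(a𝐧) = F(X_H(𝐧), Y_H(𝐧))`** — the random sum of Proposition 2.6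
is the bilinear form `F` at the rows `x_i(𝐧) = (gᵢ(a𝐧 + j))_j` and `y = 𝐧 mod P_H` (each `F_p`
read through `𝐧 mod p`, `p ∣ P_H`). [cite: TaoFMP2016, §3 (3.1)] -/
theorem Trest_mul_eq_Fbil {g₁ g₂ : ℕ → ℂ} {a : ℕ} (b h : ℤ) {Pr : Finset ℕ}
    (hPr : ∀ p ∈ Pr, p.Prime ∧ ¬p ∣ a) (H n : ℕ) {P : ℕ} (hP : ∀ p ∈ Pr, p ∣ P) :
    Trest a b h g₁ g₂ Pr H (a * n) =
      Fbil a H b h (cCoeff g₁ g₂) (seqAt g₁ (a * n)) (seqAt g₂ (a * n)) Pr ((n : ZMod P)) := by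
  unfold Trest Fbil
  exact sum_congr rfl fun p hp => sum_Zpj_mul_eq_Floc (hPr p hp).1 (hPr p hp).2 b h H n (hP p hp)

end Tao2016

end Literature.NumberTheory.LFunctions
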